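import Summits.Ventures.LatticeQCDFlow.Scaling.LumpedStarClockMixingTime
import Literature.Probability.MarkovChains.TimeAverageConcentration
import Literature.Probability.MarkovChains.ReversibleSpectrumReal

/-!
HONEST FRAMING: exact (Metropolis-corrected) sampling algorithms for lattice gauge theory; figures
of merit are autocorrelation/cost numbers at stated couplings and volumes; no continuum-physics
claim.

# LumpedStarStepSampleSize — THE HONEST SAMPLE SIZE FOR THE LUMPED STAR'S STEP CHAIN AT EVERY SWAP RATE, FROM EVERY START: SPECTRAL GAP `γ(S) ≥ (1−σ)·2σp̄/(c+2K+2)` (X3 + W27),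
# BURN-IN `r ≥ t_mix^{steps}(ε/2)` (chapter AD file 4), RUN `N ≥ (4Var_{π_S}(f)/(η²ε))·(c+2K+2)/((1−σ)·2σp̄)` ⇒ `P_x{|N⁻¹Σ_{s<N} f(X_{r+s}) − E_{π_S}f| ≥ η} ≤ ε` (lean-2 GEN-44, ours)

Venture-side (OURS).  Cell `lqcd-flow` (pub-lqcd), unit `pub-lqcd-lean-2-g44`, 2026-08-31.  Chapter AD, file 5 — the practical form of files 3–4, assembled exactly as chapter U file 6 ∕ chapter
Q file 8: Levin–Peres–Wilmer's Theorem 12.21 (`Literature/Probability/MarkovChains/TimeAverageConcentration`, in the tree) needs a burn-in past `t_mix(ε/2)` — file 4 — and a run length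
past `4Var_π(f)/(η²εγ)`; the spectral gap of the step chain `S = σA + (1−σ)B` is at least its absolute gap (`absSpectralGap_le_spectralGap`, LPW Lemma 12.1 ∕ §12.2 in the tree), and
chapter X file 4 (`stepChain_lambdaStar_le`) bounds `λ⋆(S) ≤ 1 − (1−σ)ρ` from chapter W file 27's decay `d_P(n) ≤ C₀(1−ρ)ⁿ` of the refresh-cycle chain, `ρ(c+2K+2) = 2σp̄`
(`p̄ = pE_{μ0}[Wθ]`).  Hypotheses: the union of X6's and AD3's lists (the lumped star of W27 with its resolvent end-hub laws, optimal tail couplings and cycle chain by hypothesis-equations;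
the tagged data of every oriented adjacent pair; X5's step objects), `K ≥ 2`, `c ≥ 2K+4`, `0 < σ < 1`, `μ_0 > 0`, `p̄ > 0`.

* `lumpedStar_step_spectralGap_ge` (`γ(S) ≥ (1−σ)·2σp̄/(c+2K+2)`), **`lumpedStar_step_timeAverage`**.

Reading (no numerics implied): burn-in `O((K/((1−σ)σp̄))·log(K/(σp̄ε)))` steps and averaging `O(Var·K/((1−σ)σp̄·η²ε))` steps — the sample-size recipe of the lumped star is law-free at
every swap rate (no `π_min`, no `min μ_0W`).  NOT CLAIMED: anything measured; constants.  Literature grade (cell rule): OWN COMPOSITION on X3∕X4, W27, AD3∕AD4 and the typed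
[LevinPeres2017, Thm 12.21, Lemma 12.1]; nothing new cited as a fact; no new bib keys.
-/

noncomputable section

open Finset Matrix
open Literature.Probability.MarkovChains

namespace Summit.Ventures.LatticeQCDFlow.Scaling

section StepSampleSize
variable {X : Type*} [Fintype X] [DecidableEq X] {S : Type*} [Fintype S] [DecidableEq S]
variable {hub : X → S} {comp : X → S → ℕ} {K : ℕ} {μ0 W θ : S → ℝ} {p σ c C : ℝ} {acc : S → S → ℝ} {Kh : (S → ℕ) → S → S → ℝ}
variable {u ut : X → S → ℝ} {qt q : X → X → S → S → ℝ}
variable {P : X → X → ℝ} {Q : Matrix (X × X) (X × X) ℝ} {Δ : (S → ℕ) → (S → ℕ) → ℕ} {F Ψ : X × X → ℝ}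
variable {NCf : X → X → S → ℕ} {af bf : X → X → S} {PXf PYf : X → X → Option S → Option S → ℝ} {xtf ytf xsf ysf : X → X → Option S → ℝ}
variable {Ast Bst Ust Sst : X → X → ℝ} {g : (S → ℕ) → ℝ} {πS : X → ℝ} {Z : ℝ}

/-- **The spectral gap of the lumped star's step chain:** `γ(S) ≥ (1−σ)·2σp̄/(c+2K+2)` (chapter X file 4 on chapter W file 27's cycle decay, and `γ ≥ γ⋆`). [ours] -/
theorem lumpedStar_step_spectralGap_ge [Nonempty X] [Nontrivial X] (hinj : ∀ x x', hub x = hub x' → comp x = comp x' → x = x') (hsum : ∀ x, ∑ v, comp x v = K + 1)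
    (hsurj : ∀ (z : S) (N : S → ℕ), ∑ v, N v = K + 1 → N z ≠ 0 → ∃ x, hub x = z ∧ comp x = N) (hhub : ∀ x, comp x (hub x) ≠ 0) (hK : 2 ≤ K)
    (hW : ∀ v, 0 < W v) (hp0 : 0 ≤ p) (hp : ∀ v, p * W v ≤ 1) (hθ : ∀ v, θ v = 1 / (1 + p * W v)) (hacc : ∀ h v, acc h v = min 1 (W h / W v))
    (hμ0 : ∀ v, 0 ≤ μ0 v) (hμ1 : ∑ v, μ0 v = 1) (hμpos : ∀ v, 0 < μ0 v) (hc : 2 * (K : ℝ) + 4 ≤ c) (hσ0 : 0 < σ) (hσ1 : σ < 1)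
    (hgap : 0 < p * ∑ v, μ0 v * (W v * θ v))
    (hKoff : ∀ N h v, h ≠ v → Kh N h v = if N h = 0 then 0 else (N v : ℝ) / K * acc h v) (hKdiag : ∀ N h, Kh N h h = 1 - ∑ v ∈ univ.erase h, Kh N h v)
    (hΔ : ∀ N N', Δ N N' = ∑ v, (N v - N' v))
    (hF : ∀ x y, F (x, y) = c + (-(1 - σ) * θ (hub x)) + (-(1 - σ) * θ (hub y)) + ∑ v, θ v * ((comp x v : ℝ) + (comp y v : ℝ)))
    (hC : C = 2 * ((K + 1) * (c + 2 * K + 6)))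
    (hΨ : ∀ x y, Ψ (x, y) = (Δ (comp x) (comp y) : ℝ) * F (x, y) + C * (if hub x = hub y then (0 : ℝ) else 1))
    -- the tagged data of every ORIENTED adjacent pair (as in W23 ∕ X6)
    (horient : ∀ x y, hub x = hub y → Δ (comp x) (comp y) = 1 → W (bf x y) ≤ W (af x y) ∨ W (bf y x) ≤ W (af y x))
    (hcx : ∀ x y, hub x = hub y → Δ (comp x) (comp y) = 1 → W (bf x y) ≤ W (af x y) → comp x = NCf x y + Pi.single (af x y) 1)
    (hcy : ∀ x y, hub x = hub y → Δ (comp x) (comp y) = 1 → W (bf x y) ≤ W (af x y) → comp y = NCf x y + Pi.single (bf x y) 1)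
    (hPXoff : ∀ x y, hub x = hub y → Δ (comp x) (comp y) = 1 → W (bf x y) ≤ W (af x y) →
      ∀ h v, h ≠ v → PXf x y (some h) (some v) = if NCf x y h = 0 then 0 else (NCf x y v : ℝ) / K * acc h v)
    (hPXin : ∀ x y, hub x = hub y → Δ (comp x) (comp y) = 1 → W (bf x y) ≤ W (af x y) →
      ∀ h, PXf x y (some h) none = if NCf x y h = 0 then 0 else acc h (af x y) / K)
    (hPXdiag : ∀ x y, hub x = hub y → Δ (comp x) (comp y) = 1 → W (bf x y) ≤ W (af x y) →
      ∀ h, PXf x y (some h) (some h) = 1 - (∑ v ∈ univ.erase h, PXf x y (some h) (some v) + PXf x y (some h) none))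
    (hPXout : ∀ x y, hub x = hub y → Δ (comp x) (comp y) = 1 → W (bf x y) ≤ W (af x y) → ∀ v, PXf x y none (some v) = (NCf x y v : ℝ) / K * acc (af x y) v)
    (hPXstay : ∀ x y, hub x = hub y → Δ (comp x) (comp y) = 1 → W (bf x y) ≤ W (af x y) → PXf x y none none = 1 - ∑ v, PXf x y none (some v))
    (hPYoff : ∀ x y, hub x = hub y → Δ (comp x) (comp y) = 1 → W (bf x y) ≤ W (af x y) →
      ∀ h v, h ≠ v → PYf x y (some h) (some v) = if NCf x y h = 0 then 0 else (NCf x y v : ℝ) / K * acc h v)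
    (hPYin : ∀ x y, hub x = hub y → Δ (comp x) (comp y) = 1 → W (bf x y) ≤ W (af x y) →
      ∀ h, PYf x y (some h) none = if NCf x y h = 0 then 0 else acc h (bf x y) / K)
    (hPYdiag : ∀ x y, hub x = hub y → Δ (comp x) (comp y) = 1 → W (bf x y) ≤ W (af x y) →
      ∀ h, PYf x y (some h) (some h) = 1 - (∑ v ∈ univ.erase h, PYf x y (some h) (some v) + PYf x y (some h) none))
    (hPYout : ∀ x y, hub x = hub y → Δ (comp x) (comp y) = 1 → W (bf x y) ≤ W (af x y) → ∀ v, PYf x y none (some v) = (NCf x y v : ℝ) / K * acc (bf x y) v)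
    (hPYstay : ∀ x y, hub x = hub y → Δ (comp x) (comp y) = 1 → W (bf x y) ≤ W (af x y) → PYf x y none none = 1 - ∑ v, PYf x y none (some v))
    (hxtf : ∀ x y, hub x = hub y → Δ (comp x) (comp y) = 1 → W (bf x y) ≤ W (af x y) →
      ∀ t, xtf x y t = (1 - σ) * PXf x y (some (hub x)) t + σ * ∑ t', xtf x y t' * PXf x y t' t)
    (hytf : ∀ x y, hub x = hub y → Δ (comp x) (comp y) = 1 → W (bf x y) ≤ W (af x y) →
      ∀ t, ytf x y t = (1 - σ) * PYf x y (some (hub x)) t + σ * ∑ t', ytf x y t' * PYf x y t' t)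
    (hxsf : ∀ x y, hub x = hub y → Δ (comp x) (comp y) = 1 → W (bf x y) ≤ W (af x y) →
      ∀ t, xsf x y t = (1 - σ) * PXf x y none t + σ * ∑ t', xsf x y t' * PXf x y t' t)
    (hysf : ∀ x y, hub x = hub y → Δ (comp x) (comp y) = 1 → W (bf x y) ≤ W (af x y) →
      ∀ t, ysf x y t = (1 - σ) * PYf x y none t + σ * ∑ t', ysf x y t' * PYf x y t' t)
    -- the step chain of the lumped star (file X5 `LumpedStarStepChain`)
    (hA : ∀ x x', Ast x x' = if comp x' = comp x then Kh (comp x) (hub x) (hub x') else 0)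
    (hB : ∀ x x', Bst x x' = μ0 (hub x') * (if comp x' + Pi.single (hub x) 1 = comp x + Pi.single (hub x') 1 then 1 else 0))
    (hS : ∀ x x', Sst x x' = σ * Ast x x' + (1 - σ) * Bst x x')
    (hg : ∀ N, g N = ∏ v, (μ0 v * W v) ^ (N v) / ((N v).factorial : ℝ))
    (hZ : Z = ∑ x, g (comp x) * ((comp x (hub x) : ℝ) / W (hub x))) (hπS : ∀ x, πS x = g (comp x) * ((comp x (hub x) : ℝ) / W (hub x)) / Z)
    -- the resolvent end-hub laws, optimal tail couplings and cycle chain of chapter W file 27 (as in X6)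
    (hu : ∀ x v, u x v = (1 - σ) * (if v = hub x then (1 : ℝ) else 0) + σ * ∑ h, u x h * Kh (comp x) h v)
    (hut : ∀ x v, ut x v = ∑ h, u x h * Kh (comp x) h v)
    (hqt : ∀ x y a b, qt x y a b = optimalCoupling (ut x) (ut y) a b)
    (hq : ∀ x y a b, q x y a b = (1 - σ) * ((if a = hub x then (1 : ℝ) else 0) * (if b = hub y then (1 : ℝ) else 0)) + σ * qt x y a b)
    (hP : ∀ x x', P x x' = ∑ a, u x a * (μ0 (hub x') * (if comp x' + Pi.single a 1 = comp x + Pi.single (hub x') 1 then (1 : ℝ) else 0)))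
    (hQ : ∀ x y x' y', Q (x, y) (x', y') = ∑ a, ∑ b, q x y a b * (μ0 (hub x')
      * (if comp x' + Pi.single a 1 = comp x + Pi.single (hub x') 1 then (1 : ℝ) else 0))
      * ((if hub y' = hub x' then (1 : ℝ) else 0) * (if comp y' + Pi.single b 1 = comp y + Pi.single (hub y') 1 then (1 : ℝ) else 0)))
    (hUst : ∀ x x', Ust x x' = if comp x' = comp x then u x (hub x') else 0) :
    (1 - σ) * (2 * σ * (p * ∑ v, μ0 v * (W v * θ v)) / (c + 2 * K + 2)) ≤ spectralGap πS Sst := by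
  classical
  have hK1 : 1 ≤ K := le_trans (by norm_num) hK
  have hK0 : (0 : ℝ) ≤ K := Nat.cast_nonneg _
  have hc2 : 2 * (K : ℝ) + 2 ≤ c := by linarith
  have hcK : 0 < c + 2 * K + 2 := by linarith
  have hpbar : p * ∑ v, μ0 v * (W v * θ v) ≤ 1 / 2 := by
    calc p * ∑ v, μ0 v * (W v * θ v) = ∑ v, μ0 v * (p * (W v * θ v)) := by rw [mul_sum]; exact sum_congr rfl fun v _ => by ring
      _ ≤ ∑ v, μ0 v * (1 / 2) := sum_le_sum fun v _ => mul_le_mul_of_nonneg_left (finiteOdds_pWθ_le_half hp0 hp hW hθ v) (hμ0 v)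
      _ = 1 / 2 := by rw [← sum_mul, hμ1, one_mul]
  -- the rate of chapter W file 27
  set ρ : ℝ := 2 * σ * (p * ∑ v, μ0 v * (W v * θ v)) / (c + 2 * K + 2) with hρdef
  have hρpos : 0 < ρ := div_pos (mul_pos (mul_pos two_pos hσ0) hgap) hcK
  have hρhalf : ρ ≤ 1 / 2 := by
    rw [hρdef, div_le_iff₀ hcK]
    have : σ * (p * ∑ v, μ0 v * (W v * θ v)) ≤ 1 * (1 / 2) := mul_le_mul hσ1.le hpbar hgap.le zero_le_one
    nlinarith only [this, hc2, hK0]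
  have hρc : ρ * (c + 2 * K + 2) ≤ 2 * σ * (p * ∑ v, μ0 v * (W v * θ v)) := by rw [hρdef]; apply le_of_eq; field_simp
  -- the step objects (X5) and the cycle chain (as in X6)
  have hπ := lumpedStar_piS_pos hhub hW hμpos hg hZ hπS
  have hπ1 := lumpedStar_piS_sum hhub hW hμpos hg hZ hπS
  have hA0 : ∀ x x', 0 ≤ Ast x x' := starStep_swap_nonneg hW hacc hK1 hsum hKoff hKdiag hA
  have hA1 : ∀ x, ∑ x', Ast x x' = 1 := starStep_swap_rowsum hinj hsurj hhub hsum hKoff hKdiag hA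
  have hArev : ∀ x x', πS x * Ast x x' = πS x' * Ast x' x := starStep_swap_reversible hinj hhub hW hacc hKoff hA hπS
  have hB0 : ∀ x x', 0 ≤ Bst x x' := fun x x' => by rw [hB]; exact mul_nonneg (hμ0 _) (by split_ifs <;> norm_num)
  have hB1 : ∀ x, ∑ x', Bst x x' = 1 := starStep_redraw_rowsum hinj hsurj hhub hsum hμ1 hB
  have hBrev : ∀ x x', πS x * Bst x x' = πS x' * Bst x' x := starStep_redraw_reversible hhub hW hg hπS hB
  have hBB : ∀ x x', ∑ z, Bst x z * Bst z x' = Bst x x' := starStep_redraw_idem hinj hsurj hhub hsum hμ1 hB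
  have hUcol : ∀ x y, Ust x y = (1 - σ) * (if x = y then 1 else 0) + σ * ∑ z, Ast x z * Ust z y :=
    starStep_resolvent_col hinj hsurj hhub hW hacc hK1 hsum hKoff hKdiag hσ0.le hσ1 hu hA hUst
  have hCyc : ∀ x y, P x y = ∑ z, Ust x z * Bst z y := fun x y =>
    (starStep_cycle_eq hinj hsurj hhub hW hacc hK1 hsum hKoff hKdiag hσ0.le hσ1 hu hB hUst hP x y).symm
  have hstP : IsStationary πS P :=
    lumpedStar_cycle_stationary hinj hsurj hhub hsum hK1 hW hacc hμ1 hμpos hσ0.le hσ1 hKoff hKdiag hu hP hA hB hUst hg hZ hπS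
  have hlaw := finiteOdds_worstTvDist_le hinj hsum hsurj hhub hK1 hW hp0 hp hθ hacc hμ0 hμ1 hc2 hσ0.le hσ1 hρpos.le hρhalf hρc hKoff hKdiag hu hut hqt hq hΔ
    hP hQ hF hC hΨ horient hcx hcy hPXoff hPXin hPXdiag hPXout hPXstay hPYoff hPYin hPYdiag hPYout hPYstay hxtf hytf hxsf hysf hstP (fun x => (hπ x).le) hπ1
  have hdec : ∀ n x, ∑ y, |kernelAt P n x y - πS y| ≤ 2 * (((K : ℝ) + 1) * (c + 2 * K + 2) + 2 * ((K + 1) * (c + 2 * K + 6))) * (1 - ρ) ^ n := by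
    intro n x
    have h1 : ∑ y, |kernelAt P n x y - πS y| = 2 * tvDist (lawAt P (Pi.single x 1) n) πS := by
      unfold tvDist; rw [← mul_assoc]; norm_num; rfl
    rw [h1, mul_assoc]
    exact mul_le_mul_of_nonneg_left ((tvDist_single_le_worstTvDist P πS n x).trans (hlaw n)) (by norm_num)
  have hCp0 : ∀ x y, kernelAt P 0 x y = if x = y then 1 else 0 := fun x y => by rw [kernelAt_zero_apply]; simp only [eq_comm]
  have hCpS : ∀ n x y, kernelAt P (n + 1) x y = ∑ z, kernelAt P n x z * P z y := kernelAt_succ_apply P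
  have hθ0 : 0 < 1 - ρ := by linarith
  have hθ1 : 1 - ρ ≤ 1 := by linarith
  have hirr := lumpedStar_step_irreducible hsurj hhub hW hacc hK1 hsum hKoff hKdiag hμpos hσ0 hσ1 hA hB hS
  have hlam := stepChain_lambdaStar_le hπ hπ1 hA0 hA1 hArev hσ0.le hσ1 hUcol hB0 hB1 hBrev hBB hCyc hCp0 hCpS hθ0 hθ1 hdec hS hirr
  have hSrs : IsRowStochastic Sst := stepChain_rowStochastic hA0 hA1 hB0 hB1 hσ0.le hσ1 hS
  have hDB : DetailedBalance πS Sst := stepChain_detailedBalance hArev hBrev hS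
  have hgap := absSpectralGap_le_spectralGap hπ hπ1 hSrs hDB hirr
  have e : (1 - σ) * (1 - (1 - ρ)) = (1 - σ) * ρ := by ring
  rw [e] at hlam
  calc (1 - σ) * ρ ≤ 1 - lambdaStar Sst := by linarith
    _ = absSpectralGap Sst := rfl
    _ ≤ spectralGap πS Sst := hgap

/-- **THE HONEST SAMPLE SIZE FOR THE LUMPED STAR'S STEP CHAIN** (see the module docstring). [ours] -/
theorem lumpedStar_step_timeAverage [Nonempty X] [Nontrivial X] (hinj : ∀ x x', hub x = hub x' → comp x = comp x' → x = x') (hsum : ∀ x, ∑ v, comp x v = K + 1)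
    (hsurj : ∀ (z : S) (N : S → ℕ), ∑ v, N v = K + 1 → N z ≠ 0 → ∃ x, hub x = z ∧ comp x = N) (hhub : ∀ x, comp x (hub x) ≠ 0) (hK : 2 ≤ K)
    (hW : ∀ v, 0 < W v) (hp0 : 0 ≤ p) (hp : ∀ v, p * W v ≤ 1) (hθ : ∀ v, θ v = 1 / (1 + p * W v)) (hacc : ∀ h v, acc h v = min 1 (W h / W v))
    (hμ0 : ∀ v, 0 ≤ μ0 v) (hμ1 : ∑ v, μ0 v = 1) (hμpos : ∀ v, 0 < μ0 v) (hc : 2 * (K : ℝ) + 4 ≤ c) (hσ0 : 0 < σ) (hσ1 : σ < 1)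
    (hgap : 0 < p * ∑ v, μ0 v * (W v * θ v))
    (hKoff : ∀ N h v, h ≠ v → Kh N h v = if N h = 0 then 0 else (N v : ℝ) / K * acc h v) (hKdiag : ∀ N h, Kh N h h = 1 - ∑ v ∈ univ.erase h, Kh N h v)
    (hΔ : ∀ N N', Δ N N' = ∑ v, (N v - N' v))
    (hF : ∀ x y, F (x, y) = c + (-(1 - σ) * θ (hub x)) + (-(1 - σ) * θ (hub y)) + ∑ v, θ v * ((comp x v : ℝ) + (comp y v : ℝ)))
    (hC : C = 2 * ((K + 1) * (c + 2 * K + 6)))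
    (hΨ : ∀ x y, Ψ (x, y) = (Δ (comp x) (comp y) : ℝ) * F (x, y) + C * (if hub x = hub y then (0 : ℝ) else 1))
    -- the tagged data of every ORIENTED adjacent pair (as in W23 ∕ X6)
    (horient : ∀ x y, hub x = hub y → Δ (comp x) (comp y) = 1 → W (bf x y) ≤ W (af x y) ∨ W (bf y x) ≤ W (af y x))
    (hcx : ∀ x y, hub x = hub y → Δ (comp x) (comp y) = 1 → W (bf x y) ≤ W (af x y) → comp x = NCf x y + Pi.single (af x y) 1)
    (hcy : ∀ x y, hub x = hub y → Δ (comp x) (comp y) = 1 → W (bf x y) ≤ W (af x y) → comp y = NCf x y + Pi.single (bf x y) 1)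
    (hPXoff : ∀ x y, hub x = hub y → Δ (comp x) (comp y) = 1 → W (bf x y) ≤ W (af x y) →
      ∀ h v, h ≠ v → PXf x y (some h) (some v) = if NCf x y h = 0 then 0 else (NCf x y v : ℝ) / K * acc h v)
    (hPXin : ∀ x y, hub x = hub y → Δ (comp x) (comp y) = 1 → W (bf x y) ≤ W (af x y) →
      ∀ h, PXf x y (some h) none = if NCf x y h = 0 then 0 else acc h (af x y) / K)
    (hPXdiag : ∀ x y, hub x = hub y → Δ (comp x) (comp y) = 1 → W (bf x y) ≤ W (af x y) →
      ∀ h, PXf x y (some h) (some h) = 1 - (∑ v ∈ univ.erase h, PXf x y (some h) (some v) + PXf x y (some h) none))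
    (hPXout : ∀ x y, hub x = hub y → Δ (comp x) (comp y) = 1 → W (bf x y) ≤ W (af x y) → ∀ v, PXf x y none (some v) = (NCf x y v : ℝ) / K * acc (af x y) v)
    (hPXstay : ∀ x y, hub x = hub y → Δ (comp x) (comp y) = 1 → W (bf x y) ≤ W (af x y) → PXf x y none none = 1 - ∑ v, PXf x y none (some v))
    (hPYoff : ∀ x y, hub x = hub y → Δ (comp x) (comp y) = 1 → W (bf x y) ≤ W (af x y) →
      ∀ h v, h ≠ v → PYf x y (some h) (some v) = if NCf x y h = 0 then 0 else (NCf x y v : ℝ) / K * acc h v)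
    (hPYin : ∀ x y, hub x = hub y → Δ (comp x) (comp y) = 1 → W (bf x y) ≤ W (af x y) →
      ∀ h, PYf x y (some h) none = if NCf x y h = 0 then 0 else acc h (bf x y) / K)
    (hPYdiag : ∀ x y, hub x = hub y → Δ (comp x) (comp y) = 1 → W (bf x y) ≤ W (af x y) →
      ∀ h, PYf x y (some h) (some h) = 1 - (∑ v ∈ univ.erase h, PYf x y (some h) (some v) + PYf x y (some h) none))
    (hPYout : ∀ x y, hub x = hub y → Δ (comp x) (comp y) = 1 → W (bf x y) ≤ W (af x y) → ∀ v, PYf x y none (some v) = (NCf x y v : ℝ) / K * acc (bf x y) v)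
    (hPYstay : ∀ x y, hub x = hub y → Δ (comp x) (comp y) = 1 → W (bf x y) ≤ W (af x y) → PYf x y none none = 1 - ∑ v, PYf x y none (some v))
    (hxtf : ∀ x y, hub x = hub y → Δ (comp x) (comp y) = 1 → W (bf x y) ≤ W (af x y) →
      ∀ t, xtf x y t = (1 - σ) * PXf x y (some (hub x)) t + σ * ∑ t', xtf x y t' * PXf x y t' t)
    (hytf : ∀ x y, hub x = hub y → Δ (comp x) (comp y) = 1 → W (bf x y) ≤ W (af x y) →
      ∀ t, ytf x y t = (1 - σ) * PYf x y (some (hub x)) t + σ * ∑ t', ytf x y t' * PYf x y t' t)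
    (hxsf : ∀ x y, hub x = hub y → Δ (comp x) (comp y) = 1 → W (bf x y) ≤ W (af x y) →
      ∀ t, xsf x y t = (1 - σ) * PXf x y none t + σ * ∑ t', xsf x y t' * PXf x y t' t)
    (hysf : ∀ x y, hub x = hub y → Δ (comp x) (comp y) = 1 → W (bf x y) ≤ W (af x y) →
      ∀ t, ysf x y t = (1 - σ) * PYf x y none t + σ * ∑ t', ysf x y t' * PYf x y t' t)
    -- the step chain of the lumped star (file X5 `LumpedStarStepChain`)
    (hA : ∀ x x', Ast x x' = if comp x' = comp x then Kh (comp x) (hub x) (hub x') else 0)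
    (hB : ∀ x x', Bst x x' = μ0 (hub x') * (if comp x' + Pi.single (hub x) 1 = comp x + Pi.single (hub x') 1 then 1 else 0))
    (hS : ∀ x x', Sst x x' = σ * Ast x x' + (1 - σ) * Bst x x')
    (hg : ∀ N, g N = ∏ v, (μ0 v * W v) ^ (N v) / ((N v).factorial : ℝ))
    (hZ : Z = ∑ x, g (comp x) * ((comp x (hub x) : ℝ) / W (hub x))) (hπS : ∀ x, πS x = g (comp x) * ((comp x (hub x) : ℝ) / W (hub x)) / Z)
    -- the resolvent end-hub laws, optimal tail couplings and cycle chain of chapter W file 27 (as in X6)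
    (hu : ∀ x v, u x v = (1 - σ) * (if v = hub x then (1 : ℝ) else 0) + σ * ∑ h, u x h * Kh (comp x) h v)
    (hut : ∀ x v, ut x v = ∑ h, u x h * Kh (comp x) h v)
    (hqt : ∀ x y a b, qt x y a b = optimalCoupling (ut x) (ut y) a b)
    (hq : ∀ x y a b, q x y a b = (1 - σ) * ((if a = hub x then (1 : ℝ) else 0) * (if b = hub y then (1 : ℝ) else 0)) + σ * qt x y a b)
    (hP : ∀ x x', P x x' = ∑ a, u x a * (μ0 (hub x') * (if comp x' + Pi.single a 1 = comp x + Pi.single (hub x') 1 then (1 : ℝ) else 0)))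
    (hQ : ∀ x y x' y', Q (x, y) (x', y') = ∑ a, ∑ b, q x y a b * (μ0 (hub x')
      * (if comp x' + Pi.single a 1 = comp x + Pi.single (hub x') 1 then (1 : ℝ) else 0))
      * ((if hub y' = hub x' then (1 : ℝ) else 0) * (if comp y' + Pi.single b 1 = comp y + Pi.single (hub y') 1 then (1 : ℝ) else 0)))
    (hUst : ∀ x x', Ust x x' = if comp x' = comp x then u x (hub x') else 0)
    (f : X → ℝ) {ε η : ℝ} (hε : 0 < ε) (hη : 0 < η) {r N : ℕ}
    (hr : ⌈(-Real.log (ε / 2) + Real.log (2 * (((K : ℝ) + 1) * (c + 2 * K + 2) + C) / (σ * (p * ∑ v, μ0 v * (W v * θ v)) / (c + 2 * K + 2))))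
        / Real.log (1 + (1 - σ) * (σ * (p * ∑ v, μ0 v * (W v * θ v)) / (c + 2 * K + 2)) / 48)⌉₊ ≤ r) (hN : 0 < N)
    (hNvar : 4 * lawVariance πS f / (η ^ 2 * ε) * (1 / ((1 - σ) * (2 * σ * (p * ∑ v, μ0 v * (W v * θ v)) / (c + 2 * K + 2)))) ≤ N) (x : X) :
    pathSum Sst (N + r) x (fun ω =>
        if η ≤ |(∑ s : Fin N, f ((Matrix.vecCons x ω : Fin (N + r + 1) → X) ⟨(s : ℕ) + r, by have := s.isLt; omega⟩)) / N - lawMean πS f|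
          then (1 : ℝ) else 0) ≤ ε := by
  classical
  have hK1 : 1 ≤ K := le_trans (by norm_num) hK
  have hK0 : (0 : ℝ) ≤ K := Nat.cast_nonneg _
  have hcK : 0 < c + 2 * K + 2 := by linarith
  have hπ := lumpedStar_piS_pos hhub hW hμpos hg hZ hπS
  have hπ1 := lumpedStar_piS_sum hhub hW hμpos hg hZ hπS
  have hA0 : ∀ x x', 0 ≤ Ast x x' := starStep_swap_nonneg hW hacc hK1 hsum hKoff hKdiag hA
  have hA1 : ∀ x, ∑ x', Ast x x' = 1 := starStep_swap_rowsum hinj hsurj hhub hsum hKoff hKdiag hA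
  have hArev : ∀ x x', πS x * Ast x x' = πS x' * Ast x' x := starStep_swap_reversible hinj hhub hW hacc hKoff hA hπS
  have hB0 : ∀ x x', 0 ≤ Bst x x' := fun x x' => by rw [hB]; exact mul_nonneg (hμ0 _) (by split_ifs <;> norm_num)
  have hB1 : ∀ x, ∑ x', Bst x x' = 1 := starStep_redraw_rowsum hinj hsurj hhub hsum hμ1 hB
  have hBrev : ∀ x x', πS x * Bst x x' = πS x' * Bst x' x := starStep_redraw_reversible hhub hW hg hπS hB
  have hSrs : IsRowStochastic Sst := stepChain_rowStochastic hA0 hA1 hB0 hB1 hσ0.le hσ1 hS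
  have hDB : DetailedBalance πS Sst := stepChain_detailedBalance hArev hBrev hS
  have hirr := lumpedStar_step_irreducible hsurj hhub hW hacc hK1 hsum hKoff hKdiag hμpos hσ0 hσ1 hA hB hS
  have hε2 : 0 < ε / 2 := by linarith
  -- burn-in (file 4) and `d(r₀) ≤ ε/2` (file 3)
  have hmix := lumpedStar_clock_mixingTime_le hinj hsum hsurj hhub hK hW hp0 hp hθ hacc hμ0 hμ1 hμpos hc hσ0 hσ1 hgap hKoff hKdiag hΔ hF hC hΨ horient hcx hcy hPXoff hPXin hPXdiag hPXout hPXstay hPYoff hPYin hPYdiag hPYout hPYstay hxtf hytf hxsf hysf hA hB hS hg hZ hπS hε2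
  set r₀ : ℕ := ⌈(-Real.log (ε / 2) + Real.log (2 * (((K : ℝ) + 1) * (c + 2 * K + 2) + C) / (σ * (p * ∑ v, μ0 v * (W v * θ v)) / (c + 2 * K + 2))))
        / Real.log (1 + (1 - σ) * (σ * (p * ∑ v, μ0 v * (W v * θ v)) / (c + 2 * K + 2)) / 48)⌉₊ with hr₀
  have ht₀ : worstTvDist Sst πS r₀ ≤ ε / 2 := by
    have hd := lumpedStar_clock_worstTvDist_le hinj hsum hsurj hhub hK hW hp0 hp hθ hacc hμ0 hμ1 hμpos hc hσ0 hσ1 hgap hKoff hKdiag hΔ hF hC hΨ horient hcx hcy hPXoff hPXin hPXdiag hPXout hPXstay hPYoff hPYin hPYdiag hPYout hPYstay hxtf hytf hxsf hysf hA hB hS hg hZ hπS r₀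
    have hr' : 0 < σ * (p * ∑ v, μ0 v * (W v * θ v)) / (c + 2 * K + 2) := div_pos (mul_pos hσ0 hgap) hcK
    have hεpos : 0 < (1 - σ) * (σ * (p * ∑ v, μ0 v * (W v * θ v)) / (c + 2 * K + 2)) / 48 := div_pos (mul_pos (by linarith) hr') (by norm_num)
    have hα : 0 < Real.log (1 + (1 - σ) * (σ * (p * ∑ v, μ0 v * (W v * θ v)) / (c + 2 * K + 2)) / 48) := Real.log_pos (by linarith)
    have hexp : (1 + (1 - σ) * (σ * (p * ∑ v, μ0 v * (W v * θ v)) / (c + 2 * K + 2)) / 48)⁻¹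
        = Real.exp (-Real.log (1 + (1 - σ) * (σ * (p * ∑ v, μ0 v * (W v * θ v)) / (c + 2 * K + 2)) / 48)) := by
      rw [Real.exp_neg, Real.exp_log (by linarith)]
    rw [hexp] at hd
    refine hd.trans ?_
    rw [mul_comm]
    exact exp_neg_pow_mul_le hα hε2 (Nat.le_ceil _)
  -- the run length through the gap
  have hγ := lumpedStar_step_spectralGap_ge hinj hsum hsurj hhub hK hW hp0 hp hθ hacc hμ0 hμ1 hμpos hc hσ0 hσ1 hgap hKoff hKdiag hΔ hF hC hΨ horient hcx hcy hPXoff hPXin hPXdiag hPXout hPXstay hPYoff hPYin hPYdiag hPYout hPYstay hxtf hytf hxsf hysf hA hB hS hg hZ hπS hu hut hqt hq hP hQ hUst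
  have hGpos : 0 < (1 - σ) * (2 * σ * (p * ∑ v, μ0 v * (W v * θ v)) / (c + 2 * K + 2)) :=
    mul_pos (by linarith) (div_pos (mul_pos (mul_pos two_pos hσ0) hgap) hcK)
  have hγinv : (spectralGap πS Sst)⁻¹ ≤ 1 / ((1 - σ) * (2 * σ * (p * ∑ v, μ0 v * (W v * θ v)) / (c + 2 * K + 2))) := by
    rw [← one_div]; exact one_div_le_one_div_of_le hGpos hγ
  have hV : 0 ≤ 4 * lawVariance πS f / (η ^ 2 * ε) :=
    div_nonneg (mul_nonneg (by norm_num) (lawVariance_nonneg (fun z => (hπ z).le) f)) (by positivity)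
  exact LevinPeres2017_thm_12_21 hπ hπ1 hSrs hDB hirr f hε hη ht₀ (hmix.trans hr) hN ((mul_le_mul_of_nonneg_left hγinv hV).trans hNvar) x

end StepSampleSize

end Summit.Ventures.LatticeQCDFlow.Scaling

end
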